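import Literature.Computability.Complexity.CodeFPFinite
import Literature.Computability.Complexity.CodeFPStrings
import HarnessLib

/-!
# Typed polynomial time on codes: a kit for clamped table programs

Trunk toolkit above `CodeFP.lean` / `CodeFPArith.lean` / `CodeFPBudgets.lean` / `CodeFPFinite.lean`
(the algebra `CodeFP eα eβ g` of maps computed on codes by `FP` string functions). A program that
tabulates a walk with feedback (square-and-multiply over black-box group-like operations, guarded
baby steps; first client: the class-group table of the pure cubic class-number algorithm,
`Cryptography/CubicClassTable.lean`) needs a handful of typed leaves the base files lack:

* `exists_length_le_eval` — the output-length polynomial of a computed map (the form in which a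
  black-box `CodeFP` hypothesis enters an accumulator bound of `CodeFP.foldl`);
* `testBitNat` — `Nat.testBit n i` with BOTH arguments binary (the exponent is capped by the size
  of `n` in unary, so that `2^i` is never formed for a large `i`);
* `intEModOf` (Lean's `Int.emod` of two computed integers, through `Int.emod_def`), `optGetD`
  (`Option.getD` with the default from the context);
* size lemmas: `length_intE_le_size`, `length_intE_le_of_natAbs_le`, `length_rawE_le_of_forall`,
  `length_optE_some`, `length_pairE_mk`, `length_pairE`.

## References

* S. Arora, B. Barak, *Computational Complexity: A Modern Approach*, CUP 2009, §1.3 (closure of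
  polynomial time under composition and polynomially bounded loops), §0.1 (codes). [AroraBarak2009]
-/

namespace Literature.Computability.Complexity

namespace CodeFP

open _root_.Computability Polynomial Brick

variable {α β : Type} {eα : α → List Bool} {eβ : β → List Bool}

/-! ### The output-length polynomial of a computed map -/

/-- **A map computed on codes has polynomially bounded output codes**: `|eβ (g a)| ≤ P(|eα a|)`.
[cite: AroraBarak2009, §1.3] -/
theorem exists_length_le_eval {g : α → β} (h : CodeFP eα eβ g) :
    ∃ P : Polynomial ℕ, ∀ a, (eβ (g a)).length ≤ P.eval (eα a).length := by
  obtain ⟨f, hf, hfg⟩ := h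
  obtain ⟨P, hP⟩ := exists_poly_length_le_of_mem_FP hf
  exact ⟨P, fun a => by rw [← hfg]; exact hP _⟩

/-! ### Numerals -/

/-- **Bit test with a binary position**: `(n, i) ↦ testBit n i`, computed as
`n / 2^{min(i, size n)} mod 2 = 1` (the exponent capped by the size of `n`, available in unary).
[cite: AroraBarak2009, §1.3] -/
theorem testBitNat : CodeFP (pairE natE natE) bitE (fun p => Nat.testBit p.1 p.2) := by
  have hsz : CodeFP (pairE natE natE) unE (fun p => (natE p.1).length) :=
    (strLength.comp (strOfNat.comp (fst natE natE)) :)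
  have he : CodeFP (pairE natE natE) unE (fun p => min p.2 (natE p.1).length) :=
    (unOfNatMin.comp (hsz.pair (snd natE natE)) :)
  have hpow : CodeFP (pairE natE natE) natE (fun p => 2 ^ min p.2 (natE p.1).length) :=
    (natPow.comp ((const _ (2 : ℕ)).pair he) :)
  have h : CodeFP (pairE natE natE) bitE (fun p => decide (p.1 / 2 ^ min p.2 (natE p.1).length % 2 = 1)) :=
    (natEq.comp ((natMod.comp ((natDiv.comp ((fst natE natE).pair hpow)).pair (const _ (2 : ℕ)))).pair
      (const _ (1 : ℕ))) :)
  refine h.congr fun p => ?_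
  obtain ⟨n, i⟩ := p
  simp only [length_natE]
  rcases le_total i n.size with hi | hi
  · rw [min_eq_left hi, ← Nat.testBit_eq_decide_div_mod_eq]
  · rw [min_eq_right hi, Nat.div_eq_of_lt (Nat.lt_size_self n), Nat.zero_mod,
      Nat.testBit_eq_false_of_lt ((Nat.lt_size_self n).trans_le (Nat.pow_le_pow_right Nat.two_pos hi))]
    decide

/-- **Remainder of computed integers** (pointwise; Lean's `Int.emod`: `a % b = a - b (a / b)`). [folklore] -/
theorem intEModOf {A B : α → ℤ} (hA : CodeFP eα intE A) (hB : CodeFP eα intE B) :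
    CodeFP eα intE (fun a => A a % B a) :=
  (intSub.comp (hA.pair (intMul.comp (hB.pair (intEDiv.comp (hA.pair hB)))))).congr fun a =>
    (Int.emod_def (A a) (B a)).symm

/-! ### Options -/

/-- **`Option.getD` with the default from the context.** [folklore] -/
theorem optGetD (eα : α → List Bool) : CodeFP (pairE (optE eα) eα) eα (fun p => p.1.getD p.2) := by
  have h := optCases (σ := α) (eσ := eα) (eα := eα) (eδ := eα) (k := fun d o => o.getD d)
    (gnone := fun d => d) (gsome := fun t => t.2) (CodeFP.id eα) (snd _ _) (fun _ => rfl) (fun _ _ => rfl)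
  exact (h.comp ((snd _ _).pair (fst _ _))).congr fun _ => rfl

/-! ### Sizes -/

/-- `|intE z| ≤ 2 size|z| + 2`. [folklore] -/
theorem length_intE_le_size (z : ℤ) : (intE z).length ≤ 2 * z.natAbs.size + 2 := by
  have h := length_dpEnc_le_two_mul z
  rwa [TM2Pass.length_encodeNat_eq_size] at h

/-- An integer of absolute value `≤ m` has a code of length `≤ 2 size m + 2`. [folklore] -/
theorem length_intE_le_of_natAbs_le {z : ℤ} {m : ℕ} (h : z.natAbs ≤ m) : (intE z).length ≤ 2 * m.size + 2 :=
  (length_intE_le_size z).trans (by have := Nat.size_le_size h; omega)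

/-- A raw list of `|l|` items of code length `≤ B` has code length `≤ |l| (2B + 2)`. [folklore] -/
theorem length_rawE_le_of_forall {e : α → List Bool} {l : List α} {B : ℕ} (h : ∀ a ∈ l, (e a).length ≤ B) :
    (rawE e l).length ≤ l.length * (2 * B + 2) := by
  induction l with
  | nil => simp
  | cons a l ih =>
    rw [rawE_cons, length_boolPair, List.length_cons]
    have ha := h a List.mem_cons_self
    have := ih fun x hx => h x (List.mem_cons_of_mem _ hx)
    nlinarith

/-- The code of `some a` has length `2|e a| + 2`. [folklore] -/
theorem length_optE_some (e : α → List Bool) (a : α) : (optE e (some a)).length = 2 * (e a).length + 2 := by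
  rw [optE_some, length_boolPair, List.length_nil, Nat.add_zero]

/-- Length of the code of a pair literal: `|⟨a, b⟩| = 2|eα a| + 2 + |eβ b|`. [folklore] -/
theorem length_pairE_mk (eα : α → List Bool) (eβ : β → List Bool) (a : α) (b : β) :
    (pairE eα eβ (a, b)).length = 2 * (eα a).length + 2 + (eβ b).length := by
  rw [pairE_apply, length_boolPair]

/-- Length of the code of a pair: `|pairE eα eβ p| = 2|eα p.1| + 2 + |eβ p.2|`. [folklore] -/
theorem length_pairE (eα : α → List Bool) (eβ : β → List Bool) (p : α × β) :
    (pairE eα eβ p).length = 2 * (eα p.1).length + 2 + (eβ p.2).length := by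
  rw [pairE_apply, length_boolPair]

end CodeFP

end Literature.Computability.Complexity
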